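import Summits.HubbardSuperconductivity.HubbardSuperconductivity.Theorems.AnisotropyChordTransferFibre3KT2aRow
import Summits.HubbardSuperconductivity.HubbardSuperconductivity.Theorems.AnisotropyChordTransferFibre3OneLoop

/-!
# Route `AnisotropyChord` / H0 rotor rung: PartN41-D §3 — `TripleConvolution` PROVED

Theory-1 g22's PartN41-D §3 `TripleConvolution` (port …Fibre3KT2aRow): for `G(a,b) = g₁(a)g₂(b)g₃(b − a)`,
★ `cfgDFT G (k₂,k₃) = (1/V)Σ_p ĝ₃(p)ĝ₁(k₂ + p)ĝ₂(k₃ − p)` (the three-function version of the landed `piHatOneLoop_holds`, same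
character bookkeeping `conj_phase_triple`/`sum_conj_phase_left`) and ★ `cfgDFT (v·G)(k) = Ĝ(k₂,k₃) + Ĝ(k₂−K₁,k₃) + Ĝ(k₂,k₃−K₁)`
(`v = 1 + e^{iK₁·a} + e^{iK₁·b}`, `conj φ_{k−K₁}(a) = conj φ_k(a)·φ_{K₁}(a)`): ★ `tripleConvolution_holds : TripleConvolution L`.
Prover seat `hubbard-h0-rotor-p1` g27 (route lead); helper for stmt-HubbardSuperconductivity-23918 (`--supports`, helper class).
WHAT THIS IS NOT: nothing here proves superconductivity in the Hubbard model.  Tree imports only; no new definitions; no sorry.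
-/

set_option linter.dupNamespace false
set_option autoImplicit false

noncomputable section

open scoped BigOperators

namespace Summit.HubbardSuperconductivity.HubbardSuperconductivity.Theorems.AnisotropyChord.Transfer.Fibre3

variable (L : ℕ) [NeZero L]

namespace RowD

/-- ★ the one-loop form of the transform of a trilinear product state. [folklore] -/
theorem cfgDFT_prod3 (g₁ g₂ g₃ : Tor L → ℝ) (q₂ q₃ : Tor L) :
    cfgDFT L (fun c => ((prod3 L g₁ g₂ g₃ c : ℝ) : ℂ)) q₂ q₃
      = (∑ p : Tor L, dft L g₃ p * dft L g₁ (q₂ + p) * dft L g₂ (q₃ - p)) / (L : ℂ) ^ 2 := by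
  have hV : ((L : ℂ) ^ 2) ≠ 0 := by
    have : (L : ℂ) ≠ 0 := by exact_mod_cast (NeZero.ne L)
    positivity
  rw [eq_div_iff hV]
  unfold dft cfgDFT
  -- expand the triple product
  have e1 : ∑ p : Tor L, (∑ r : Tor L, (starRingEnd ℂ) (phase L p r) * (g₃ r : ℂ))
        * (∑ s : Tor L, (starRingEnd ℂ) (phase L (q₂ + p) s) * (g₁ s : ℂ))
        * (∑ t : Tor L, (starRingEnd ℂ) (phase L (q₃ - p) t) * (g₂ t : ℂ))
      = ∑ s : Tor L, ∑ t : Tor L, ∑ r : Tor L,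
          ((g₃ r : ℂ) * (g₁ s : ℂ) * (g₂ t : ℂ) * (starRingEnd ℂ) (phase L q₂ s * phase L q₃ t))
            * ∑ p : Tor L, (starRingEnd ℂ) (phase L p (r + s - t)) := by
    calc ∑ p : Tor L, (∑ r : Tor L, (starRingEnd ℂ) (phase L p r) * (g₃ r : ℂ))
          * (∑ s : Tor L, (starRingEnd ℂ) (phase L (q₂ + p) s) * (g₁ s : ℂ))
          * (∑ t : Tor L, (starRingEnd ℂ) (phase L (q₃ - p) t) * (g₂ t : ℂ))
        = ∑ p : Tor L, ∑ r : Tor L, ∑ s : Tor L, ∑ t : Tor L,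
            ((g₃ r : ℂ) * (g₁ s : ℂ) * (g₂ t : ℂ) * (starRingEnd ℂ) (phase L q₂ s * phase L q₃ t))
              * (starRingEnd ℂ) (phase L p (r + s - t)) := by
          refine Finset.sum_congr rfl fun p _ => ?_
          rw [Finset.sum_mul_sum, Finset.sum_mul]
          refine Finset.sum_congr rfl fun r _ => ?_
          rw [Finset.sum_mul]
          refine Finset.sum_congr rfl fun s _ => ?_
          rw [Finset.mul_sum]
          refine Finset.sum_congr rfl fun t _ => ?_
          have := conj_phase_triple L p q₂ q₃ r s t
          calc (starRingEnd ℂ) (phase L p r) * (g₃ r : ℂ) * ((starRingEnd ℂ) (phase L (q₂ + p) s) * (g₁ s : ℂ))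
                * ((starRingEnd ℂ) (phase L (q₃ - p) t) * (g₂ t : ℂ))
              = ((starRingEnd ℂ) (phase L p r) * (starRingEnd ℂ) (phase L (q₂ + p) s)
                  * (starRingEnd ℂ) (phase L (q₃ - p) t)) * ((g₃ r : ℂ) * (g₁ s : ℂ) * (g₂ t : ℂ)) := by ring
            _ = _ := by rw [this]; ring
      _ = ∑ r : Tor L, ∑ p : Tor L, ∑ s : Tor L, ∑ t : Tor L,
            ((g₃ r : ℂ) * (g₁ s : ℂ) * (g₂ t : ℂ) * (starRingEnd ℂ) (phase L q₂ s * phase L q₃ t))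
              * (starRingEnd ℂ) (phase L p (r + s - t)) := Finset.sum_comm
      _ = ∑ r : Tor L, ∑ s : Tor L, ∑ p : Tor L, ∑ t : Tor L,
            ((g₃ r : ℂ) * (g₁ s : ℂ) * (g₂ t : ℂ) * (starRingEnd ℂ) (phase L q₂ s * phase L q₃ t))
              * (starRingEnd ℂ) (phase L p (r + s - t)) := by
          refine Finset.sum_congr rfl fun r _ => ?_; exact Finset.sum_comm
      _ = ∑ r : Tor L, ∑ s : Tor L, ∑ t : Tor L, ∑ p : Tor L,
            ((g₃ r : ℂ) * (g₁ s : ℂ) * (g₂ t : ℂ) * (starRingEnd ℂ) (phase L q₂ s * phase L q₃ t))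
              * (starRingEnd ℂ) (phase L p (r + s - t)) := by
          refine Finset.sum_congr rfl fun r _ => Finset.sum_congr rfl fun s _ => ?_; exact Finset.sum_comm
      _ = ∑ r : Tor L, ∑ s : Tor L, ∑ t : Tor L,
            ((g₃ r : ℂ) * (g₁ s : ℂ) * (g₂ t : ℂ) * (starRingEnd ℂ) (phase L q₂ s * phase L q₃ t))
              * ∑ p : Tor L, (starRingEnd ℂ) (phase L p (r + s - t)) := by
          refine Finset.sum_congr rfl fun r _ => Finset.sum_congr rfl fun s _ => Finset.sum_congr rfl fun t _ => ?_
          rw [Finset.mul_sum]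
      _ = ∑ s : Tor L, ∑ r : Tor L, ∑ t : Tor L,
            ((g₃ r : ℂ) * (g₁ s : ℂ) * (g₂ t : ℂ) * (starRingEnd ℂ) (phase L q₂ s * phase L q₃ t))
              * ∑ p : Tor L, (starRingEnd ℂ) (phase L p (r + s - t)) := Finset.sum_comm
      _ = _ := by
          refine Finset.sum_congr rfl fun s _ => ?_; exact Finset.sum_comm
  rw [e1]
  -- the character sum forces `r = t − s`
  have e2 : ∀ s t : Tor L, ∑ r : Tor L,
        ((g₃ r : ℂ) * (g₁ s : ℂ) * (g₂ t : ℂ) * (starRingEnd ℂ) (phase L q₂ s * phase L q₃ t))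
          * ∑ p : Tor L, (starRingEnd ℂ) (phase L p (r + s - t))
      = (starRingEnd ℂ) (phase L q₂ s * phase L q₃ t) * (((g₁ s * g₂ t * g₃ (t - s) : ℝ)) : ℂ) * (L : ℂ) ^ 2 := by
    intro s t
    simp_rw [sum_conj_phase_left]
    have hcond : ∀ r : Tor L, (r + s - t = 0) ↔ (r = t - s) := by
      intro r; constructor <;> intro h
      · have := congrArg (· + (t - s)) h; simp at this; linear_combination h
      · rw [h]; abel
    have : ∀ r : Tor L, ((g₃ r : ℂ) * (g₁ s : ℂ) * (g₂ t : ℂ) * (starRingEnd ℂ) (phase L q₂ s * phase L q₃ t))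
          * (if r + s - t = 0 then ((L : ℂ) ^ 2) else 0)
        = if r = t - s then (g₃ r : ℂ) * (g₁ s : ℂ) * (g₂ t : ℂ) * (starRingEnd ℂ) (phase L q₂ s * phase L q₃ t) * (L : ℂ) ^ 2
          else 0 := by
      intro r; rw [if_congr (hcond r) rfl rfl]; split_ifs <;> ring
    rw [Finset.sum_congr rfl fun r _ => this r, Finset.sum_ite_eq' Finset.univ (t - s)]
    simp only [Finset.mem_univ, if_true]
    push_cast; ring
  simp_rw [e2]
  rw [Fintype.sum_prod_type, Finset.sum_mul]
  refine Finset.sum_congr rfl fun s _ => ?_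
  rw [Finset.sum_mul]
  refine Finset.sum_congr rfl fun t _ => ?_
  unfold prod3
  simp only

/-- `conj φ_{k − K₁}(a) = conj φ_k(a) · φ_{K₁}(a)`. [folklore] -/
theorem conj_phase_sub_K1 (k a : Tor L) :
    (starRingEnd ℂ) (phase L (k - K1 L) a) = (starRingEnd ℂ) (phase L k a) * phase L (K1 L) a := by
  rw [sub_eq_add_neg, phase_add_left, map_mul, phase_neg_left, conj_phase, conj_phase, neg_neg]

/-- ★ the transform against `v = 1 + e^{iK₁a} + e^{iK₁b}`: three translates. [folklore] -/
theorem cfgDFT_vfun_mul (G : Cfg L → ℂ) (k₂ k₃ : Tor L) :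
    cfgDFT L (fun c => vfun L c * G c) k₂ k₃
      = cfgDFT L G k₂ k₃ + cfgDFT L G (k₂ - K1 L) k₃ + cfgDFT L G k₂ (k₃ - K1 L) := by
  unfold cfgDFT vfun
  rw [← Finset.sum_add_distrib, ← Finset.sum_add_distrib]
  refine Finset.sum_congr rfl fun c _ => ?_
  rw [map_mul, map_mul, map_mul, conj_phase_sub_K1, conj_phase_sub_K1]
  ring

end RowD

/-- ★ **`TripleConvolution L` holds.** [folklore] -/
theorem tripleConvolution_holds : TripleConvolution L := by
  intro g₁ g₂ g₃ k₂ k₃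
  exact ⟨RowD.cfgDFT_prod3 L g₁ g₂ g₃ k₂ k₃, RowD.cfgDFT_vfun_mul L _ k₂ k₃⟩

end Summit.HubbardSuperconductivity.HubbardSuperconductivity.Theorems.AnisotropyChord.Transfer.Fibre3

end
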